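import Summits.AnomalousDissipation.AnomalousDissipation.Theorems.SawtoothPulseCascadeK1LocalisedCascadeKHLineKernel
import Summits.AnomalousDissipation.AnomalousDissipation.Theorems.SawtoothPulseCascadeK1LocalisedCascadeKHSheetBlock
import Summits.AnomalousDissipation.AnomalousDissipation.Theorems.SawtoothPulseCascadeK1LocalisedCascadeKHStableDetuning

/-!
# K2 lane (route-2 `SawtoothPulseCascade`, crux dir `K1LocalisedCascade`): the kink-pair FRAME of the Kelvin–Helmholtz block — `X` is off-diagonal, the pole sits in one entry only

Helper file of the K2 lane (ACL item stmt-AnomalousDissipation-19491; arbiter A28-11, the corner law; memo §30 (M2)).  In the frame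
`u_b = (e^{iπb/2}, e^{−iπb/2})`, `v_b = (e^{iπb/2}, −e^{−iπb/2})` of the two kink lines, p4's block `X = 2πia·[[−¼ − 2G0, −2Gh],[2Ḡh, ¼ + 2G0]]`
(`2πG0 = Σ₀`, `2πḠh = S`) is OFF-DIAGONAL: writing `U(f) = f₀e^{−iπb/2} + f₁e^{iπb/2}`, `V(f) = f₀e^{−iπb/2} − f₁e^{iπb/2}`,
`U(Xf) = x_vu·V(f)`, `V(Xf) = x_uv·U(f)` with `x_vu = ia(−π/2 − 2Σ₀ + 2e^{iπb}S)`, `x_uv = ia(−π/2 − 2Σ₀ − 2e^{iπb}S)` (`frame_mulVec_U`, `frame_mulVec_V`;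
the only input is the reality of `e^{iπb}S`).  The closed form `e^{iπb}S = −e^{−aπ}(1−q)cos(πb)/(a(1 − 2q cos 2πb + q²))` (`cexp_pi_mul_sawS`) shows that the
pole `1/(a²+b²)` of `Σ₀` CANCELS in `x_vu`: for `|b| ≤ ½`, `‖−π/2 − 2Σ₀ + 2e^{iπb}S‖ ≤ 3π/2` (`norm_frameCoef_vu_le`, so `|x_vu| ≤ 3πa/2`), while
`‖−π/2 − 2Σ₀ − 2e^{iπb}S‖ ≤ π/2 + 2(1+q)/(a(1−q))` (`norm_frameCoef_uv_le`, `|x_uv| = O(1/a)`).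
No definitions; no statement about the crux. [cite: Drazin2002, §8.3 (8.36)–(8.38)] [problem: turb]
-/

-- `Summit.<Summit>.<Problem>`: single-conjunct summit, the duplicate namespace segment is deliberate.
set_option linter.dupNamespace false

noncomputable section

namespace Summit.AnomalousDissipation.AnomalousDissipation.Theorems.SawtoothPulseCascade.K2PhaseBudget

open Literature.Analysis.FluidPDE.SawtoothCascade

/-! ## §1 The phase of the off-diagonal lattice sum: `e^{iπβ} S_β(a)` is real -/

/-- **`e^{iπβ} S_β(k) = −e^{−kπ}(1−q)cos(πβ)/(k(1 − 2q cos 2πβ + q²))`** (`k > 0`, `q = e^{−2πk}`): with `w = e^{iπβ}`, `z = w²`,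
`1/(1−zq) + z̄/(1−z̄q) = (1−q)(1+z̄)/|1−zq|²` and `w(1+z̄) = w + w̄ = 2cos πβ`. [cite: Drazin2002, §8.3 (8.36)–(8.38)] -/
theorem cexp_pi_mul_sawS {k : ℝ} (hk : 0 < k) (β : ℝ) :
    Complex.exp (((Real.pi * β : ℝ) : ℂ) * Complex.I) * sawS k β =
      (-(Real.exp (-(k * Real.pi)) * (1 - sawQ k) * Real.cos (Real.pi * β)) /
        (k * (1 - 2 * sawQ k * Real.cos (2 * Real.pi * β) + sawQ k ^ 2)) : ℝ) := by
  set w : ℂ := Complex.exp (((Real.pi * β : ℝ) : ℂ) * Complex.I) with hw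
  set z : ℂ := Complex.exp (((2 * Real.pi * β : ℝ) : ℂ) * Complex.I) with hz
  set q : ℝ := sawQ k with hq
  have hzw : z = w ^ 2 := by rw [hw, hz, sq, ← Complex.exp_add]; congr 1; push_cast; ring
  have hwn : ‖w‖ = 1 := Complex.norm_exp_ofReal_mul_I _
  have hzn : ‖z‖ = 1 := Complex.norm_exp_ofReal_mul_I _
  have hww : w * starRingEnd ℂ w = 1 := by rw [Complex.mul_conj, Complex.normSq_eq_norm_sq, hwn]; simp
  have hwre : w + starRingEnd ℂ w = ((2 * Real.cos (Real.pi * β) : ℝ) : ℂ) := by rw [hw, Complex.add_conj, Complex.exp_ofReal_mul_I_re]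
  have hzre : z + starRingEnd ℂ z = ((2 * Real.cos (2 * Real.pi * β) : ℝ) : ℂ) := blochZ_add_conj β
  have hzz : z * starRingEnd ℂ z = 1 := blochZ_mul_conj β
  have hzc : starRingEnd ℂ z = starRingEnd ℂ w ^ 2 := by rw [hzw, map_pow]
  have hq0 : 0 < q := sawQ_pos k
  have hq1 : q < 1 := sawQ_lt_one hk
  have hd1 : 1 - z * (q : ℂ) ≠ 0 := one_sub_mul_ne_zero hzn hq0.le hq1
  have hd2 : 1 - starRingEnd ℂ z * (q : ℂ) ≠ 0 := one_sub_mul_ne_zero (by rw [Complex.norm_conj]; exact hzn) hq0.le hq1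
  have hc := Real.cos_le_one (2 * Real.pi * β)
  have hN : 0 < 1 - 2 * q * Real.cos (2 * Real.pi * β) + q ^ 2 := by nlinarith
  have hzre' := hzre
  push_cast at hzre'
  have hNc : (1 - z * (q : ℂ)) * (1 - starRingEnd ℂ z * (q : ℂ)) = ((1 - 2 * q * Real.cos (2 * Real.pi * β) + q ^ 2 : ℝ) : ℂ) := by
    push_cast
    linear_combination (-(q : ℂ)) * hzre' + (q : ℂ) ^ 2 * hzz
  have hzz' : starRingEnd ℂ z * z = 1 := by rw [mul_comm]; exact hzz
  have hsum : 1 / (1 - z * (q : ℂ)) + starRingEnd ℂ z / (1 - starRingEnd ℂ z * (q : ℂ)) =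
      ((1 - (q : ℂ)) * (1 + starRingEnd ℂ z)) / (((1 - 2 * q * Real.cos (2 * Real.pi * β) + q ^ 2 : ℝ) : ℂ)) := by
    rw [div_add_div _ _ hd1 hd2, hNc]
    congr 1
    linear_combination (-(q : ℂ)) * hzz'
  have hwz : w * (1 + starRingEnd ℂ z) = ((2 * Real.cos (Real.pi * β) : ℝ) : ℂ) := by
    rw [← hwre, hzc]
    linear_combination (starRingEnd ℂ w) * hww
  have hk' : (k : ℂ) ≠ 0 := by exact_mod_cast hk.ne'
  have hN' : (((1 - 2 * q * Real.cos (2 * Real.pi * β) + q ^ 2 : ℝ)) : ℂ) ≠ 0 := by exact_mod_cast hN.ne'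
  simp only [sawS]
  rw [← hz, ← hq, hsum]
  rw [show w * (-(((Real.exp (-(k * Real.pi)) / (2 * k) : ℝ) : ℂ)) * ((1 - (q : ℂ)) * (1 + starRingEnd ℂ z) /
      (((1 - 2 * q * Real.cos (2 * Real.pi * β) + q ^ 2 : ℝ)) : ℂ))) =
      -(((Real.exp (-(k * Real.pi)) / (2 * k) : ℝ) : ℂ)) * (1 - (q : ℂ)) * (w * (1 + starRingEnd ℂ z)) /
        (((1 - 2 * q * Real.cos (2 * Real.pi * β) + q ^ 2 : ℝ)) : ℂ) by ring, hwz]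
  push_cast
  field_simp

/-- `e^{iπβ} S_β(k)` is real: it equals its own conjugate (`k > 0`). [cite: Drazin2002, §8.3 (8.36)–(8.38)] -/
theorem conj_cexp_pi_mul_sawS {k : ℝ} (hk : 0 < k) (β : ℝ) :
    starRingEnd ℂ (Complex.exp (((Real.pi * β : ℝ) : ℂ) * Complex.I) * sawS k β) = Complex.exp (((Real.pi * β : ℝ) : ℂ) * Complex.I) * sawS k β := by
  rw [cexp_pi_mul_sawS hk β, Complex.conj_ofReal]

/-! ## §2 The two frame coefficients: the pole cancels in `x_vu`, survives in `x_uv` -/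

/-- **The pole-free frame coefficient.** For `a > 0` and `|β| ≤ ½`:
`‖(−π/2 − 2Σ₀(a,β)) + 2e^{iπβ}S_β(a)‖ ≤ 3π/2` — indeed `−2Σ₀ + 2e^{iπβ}S = (1−q)((1+q) − 2√q cos πβ)/(aD) ∈ [0, (1−q)/a] ⊆ [0, 2π]`
(`D = (1+q)² − 4q cos²πβ`), the `1/(a²+β²)` poles of `Σ₀` and `S` cancelling. [cite: Drazin2002, §8.3 (8.36)–(8.38)] -/
theorem norm_frameCoef_vu_le {a : ℝ} (ha : 0 < a) {β : ℝ} (hβ : |β| ≤ 1 / 2) :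
    ‖(((-(Real.pi / 2) - 2 * sawSigma0 a β) : ℝ) : ℂ) + 2 * (Complex.exp (((Real.pi * β : ℝ) : ℂ) * Complex.I) * sawS a β)‖ ≤ 3 * Real.pi / 2 := by
  rw [cexp_pi_mul_sawS ha β]
  set q : ℝ := sawQ a with hq
  set s : ℝ := Real.exp (-(a * Real.pi)) with hs
  set c : ℝ := Real.cos (Real.pi * β) with hc
  have hπ := Real.pi_pos
  have hq0 : 0 < q := sawQ_pos a
  have hq1 : q < 1 := sawQ_lt_one ha
  have hs0 : 0 < s := Real.exp_pos _
  have hsq : s ^ 2 = q := by rw [hs, hq, sawQ, sq, ← Real.exp_add]; congr 1; ring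
  have hc0 : 0 ≤ c := by
    rw [hc]
    apply Real.cos_nonneg_of_neg_pi_div_two_le_of_le <;> nlinarith [abs_le.1 hβ]
  have hc1 : c ≤ 1 := Real.cos_le_one _
  have hcos2 : Real.cos (2 * Real.pi * β) = 2 * c ^ 2 - 1 := by
    rw [hc, show 2 * Real.pi * β = 2 * (Real.pi * β) by ring, Real.cos_two_mul]
  -- `D = 1 − 2q cos 2πβ + q² = (1+q)² − 4qc² = P·M`, `P = (1+q) − 2sc ≥ 0`, `M = (1+q) + 2sc ≥ 1`
  set P : ℝ := (1 + q) - 2 * s * c with hP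
  set M : ℝ := (1 + q) + 2 * s * c with hM
  have hD : 1 - 2 * q * Real.cos (2 * Real.pi * β) + q ^ 2 = P * M := by rw [hcos2, hP, hM, ← hsq]; ring
  have hP0 : 0 ≤ P := by nlinarith [sq_nonneg (1 - s), mul_nonneg hs0.le (sub_nonneg.2 hc1)]
  have hM1 : 1 ≤ M := by nlinarith [mul_nonneg hs0.le hc0]
  have hDpos : 0 < P * M := by rw [← hD]; nlinarith [Real.cos_le_one (2 * Real.pi * β)]
  have hPpos : 0 < P := lt_of_le_of_ne hP0 (fun h => by rw [← h, zero_mul] at hDpos; exact lt_irrefl 0 hDpos)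
  -- the combination in closed form
  have hT : (-(Real.pi / 2) - 2 * sawSigma0 a β) + 2 * ((-(s * (1 - q) * c)) / (a * (1 - 2 * q * Real.cos (2 * Real.pi * β) + q ^ 2))) =
      -(Real.pi / 2) + (1 - q) / (a * M) := by
    rw [sawSigma0, ← hq, hD]
    field_simp
    ring
  have hT0 : 0 ≤ (1 - q) / (a * M) := by positivity
  have hT1 : (1 - q) / (a * M) ≤ 2 * Real.pi := by
    rw [div_le_iff₀ (by positivity)]
    have h1q : 1 - q ≤ 2 * Real.pi * a := by
      have := Real.add_one_le_exp (-(2 * Real.pi * a)); rw [hq, sawQ]; linarith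
    nlinarith
  have hreal : (((-(Real.pi / 2) - 2 * sawSigma0 a β) : ℝ) : ℂ) + 2 * ((((-(s * (1 - q) * c)) / (a * (1 - 2 * q * Real.cos (2 * Real.pi * β) + q ^ 2))) : ℝ) : ℂ) =
      (((-(Real.pi / 2) + (1 - q) / (a * M)) : ℝ) : ℂ) := by
    rw [← hT]; push_cast; ring
  rw [hreal, Complex.norm_real, Real.norm_eq_abs]
  exact abs_le.2 ⟨by linarith, by linarith⟩

/-- **The pole-carrying frame coefficient (crude):** `‖(−π/2 − 2Σ₀(a,β)) − 2e^{iπβ}S_β(a)‖ ≤ π/2 + 2(1+q)/(a(1−q))` for `a > 0`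
(`‖S‖ ≤ |Σ₀| ≤ (1+q)/(2a(1−q))`, tree `normSq_sawS_lt_sq_sawSigma0`, `le_sawSigma0_of_pos`). [cite: Drazin2002, §8.3 (8.36)–(8.38)] -/
theorem norm_frameCoef_uv_le {a : ℝ} (ha : 0 < a) (β : ℝ) :
    ‖(((-(Real.pi / 2) - 2 * sawSigma0 a β) : ℝ) : ℂ) - 2 * (Complex.exp (((Real.pi * β : ℝ) : ℂ) * Complex.I) * sawS a β)‖ ≤
      Real.pi / 2 + 2 * (1 + sawQ a) / (a * (1 - sawQ a)) := by
  have hπ := Real.pi_pos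
  have hq0 : 0 < sawQ a := sawQ_pos a
  have hq1 : sawQ a < 1 := sawQ_lt_one ha
  have hSig : sawSigma0 a β < 0 := sawSigma0_neg ha β
  have hSigle := le_sawSigma0_of_pos ha β
  have hS : ‖sawS a β‖ ≤ -sawSigma0 a β := by
    have h := normSq_sawS_lt_sq_sawSigma0 ha β
    rw [Complex.normSq_eq_norm_sq] at h
    nlinarith [norm_nonneg (sawS a β)]
  have hw : ‖Complex.exp (((Real.pi * β : ℝ) : ℂ) * Complex.I)‖ = 1 := Complex.norm_exp_ofReal_mul_I _
  calc ‖(((-(Real.pi / 2) - 2 * sawSigma0 a β) : ℝ) : ℂ) - 2 * (Complex.exp (((Real.pi * β : ℝ) : ℂ) * Complex.I) * sawS a β)‖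
      ≤ ‖(((-(Real.pi / 2) - 2 * sawSigma0 a β) : ℝ) : ℂ)‖ + ‖2 * (Complex.exp (((Real.pi * β : ℝ) : ℂ) * Complex.I) * sawS a β)‖ := norm_sub_le _ _
    _ = |-(Real.pi / 2) - 2 * sawSigma0 a β| + 2 * ‖sawS a β‖ := by
        rw [Complex.norm_real, Real.norm_eq_abs, norm_mul, norm_mul, hw, one_mul]; norm_num
    _ ≤ (Real.pi / 2 + 2 * (-sawSigma0 a β)) + 2 * (-sawSigma0 a β) := by
        gcongr
        exact abs_le.2 ⟨by linarith, by linarith⟩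
    _ = Real.pi / 2 + 4 * (-sawSigma0 a β) := by ring
    _ ≤ Real.pi / 2 + 4 * ((1 + sawQ a) / (2 * a * (1 - sawQ a))) := by
        have : -sawSigma0 a β ≤ (1 + sawQ a) / (2 * a * (1 - sawQ a)) := by rw [neg_div] at hSigle; linarith
        gcongr
    _ = Real.pi / 2 + 2 * (1 + sawQ a) / (a * (1 - sawQ a)) := by
        have : (1 - sawQ a) ≠ 0 := by linarith
        field_simp
        ring

/-! ## §3 The block in the kink-pair frame -/

/-- From `2πḠh = S` and the reality of `e^{iπb}S`: `Gh·e^{−iπb} = Ḡh·e^{iπb}`. [cite: Drazin2002, §8.3 (8.36)–(8.38)] -/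
theorem frame_rel_of {a b : ℝ} (ha : 0 < a) {Gh : ℂ} (hh : (2 * Real.pi : ℂ) * starRingEnd ℂ Gh = sawS a b) :
    Gh * Complex.exp (-((Real.pi * b : ℝ) : ℂ) * Complex.I) = starRingEnd ℂ Gh * Complex.exp (((Real.pi * b : ℝ) : ℂ) * Complex.I) := by
  have hπ : (2 * Real.pi : ℂ) ≠ 0 := by exact_mod_cast (by positivity : (0 : ℝ) < 2 * Real.pi).ne'
  have hGb : starRingEnd ℂ Gh = sawS a b / (2 * Real.pi) := by rw [← hh]; field_simp
  have hG : Gh = starRingEnd ℂ (sawS a b) / (2 * Real.pi) := by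
    have := congrArg (starRingEnd ℂ) hGb
    rw [Complex.conj_conj, map_div₀] at this
    rw [this]; congr 1
    simp only [map_mul, map_ofNat, Complex.conj_ofReal]
  have hwc : starRingEnd ℂ (Complex.exp (((Real.pi * b : ℝ) : ℂ) * Complex.I)) = Complex.exp (-((Real.pi * b : ℝ) : ℂ) * Complex.I) := by
    rw [← Complex.exp_conj]; congr 1
    simp only [map_mul, Complex.conj_ofReal, Complex.conj_I]; ring
  have hreal := conj_cexp_pi_mul_sawS ha b
  rw [map_mul, hwc] at hreal
  rw [hGb, hG, div_mul_eq_mul_div, div_mul_eq_mul_div]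
  congr 1
  rw [mul_comm, hreal, mul_comm]

/-- **`U(Xf) = x_vu · V(f)`:** for the block `X = 2πia·[[−¼ − 2G0, −2Gh],[2Ḡh, ¼ + 2G0]]` with `Gh e^{−iπb} = Ḡh e^{iπb}`,
`(Xf)₀e^{−iπb/2} + (Xf)₁e^{iπb/2} = 2πia(−¼ − 2G0 + 2Ḡh e^{iπb})·(f₀e^{−iπb/2} − f₁e^{iπb/2})`. [cite: Drazin2002, §8.3 (8.36)–(8.38)] -/
theorem frame_mulVec_U (a b : ℝ) {G0 Gh : ℂ}
    (hrel : Gh * Complex.exp (-((Real.pi * b : ℝ) : ℂ) * Complex.I) = starRingEnd ℂ Gh * Complex.exp (((Real.pi * b : ℝ) : ℂ) * Complex.I))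
    (f : Fin 2 → ℂ) :
    ((((2 * Real.pi * a : ℝ) : ℂ) * Complex.I) • !![-(1 / 4 : ℂ) - 2 * G0, -2 * Gh; 2 * starRingEnd ℂ Gh, (1 / 4 : ℂ) + 2 * G0]).mulVec f 0 *
          Complex.exp (-((Real.pi * b / 2 : ℝ) : ℂ) * Complex.I) +
        ((((2 * Real.pi * a : ℝ) : ℂ) * Complex.I) • !![-(1 / 4 : ℂ) - 2 * G0, -2 * Gh; 2 * starRingEnd ℂ Gh, (1 / 4 : ℂ) + 2 * G0]).mulVec f 1 *
          Complex.exp (((Real.pi * b / 2 : ℝ) : ℂ) * Complex.I) =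
      ((((2 * Real.pi * a : ℝ) : ℂ) * Complex.I) * (-(1 / 4 : ℂ) - 2 * G0 + 2 * starRingEnd ℂ Gh * Complex.exp (((Real.pi * b : ℝ) : ℂ) * Complex.I))) *
        (f 0 * Complex.exp (-((Real.pi * b / 2 : ℝ) : ℂ) * Complex.I) - f 1 * Complex.exp (((Real.pi * b / 2 : ℝ) : ℂ) * Complex.I)) := by
  set ep : ℂ := Complex.exp (((Real.pi * b / 2 : ℝ) : ℂ) * Complex.I) with hep
  set em : ℂ := Complex.exp (-((Real.pi * b / 2 : ℝ) : ℂ) * Complex.I) with hem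
  have hpm : ep * em = 1 := by rw [hep, hem, ← Complex.exp_add]; convert Complex.exp_zero using 2; push_cast; ring
  have hep2 : Complex.exp (((Real.pi * b : ℝ) : ℂ) * Complex.I) = ep ^ 2 := by rw [hep, sq, ← Complex.exp_add]; congr 1; push_cast; ring
  have hem2 : Complex.exp (-((Real.pi * b : ℝ) : ℂ) * Complex.I) = em ^ 2 := by rw [hem, sq, ← Complex.exp_add]; congr 1; push_cast; ring
  rw [hep2]
  rw [hep2, hem2] at hrel
  set σ : ℂ := (((2 * Real.pi * a : ℝ) : ℂ) * Complex.I) with hσ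
  set M : Matrix (Fin 2) (Fin 2) ℂ := σ • !![-(1 / 4 : ℂ) - 2 * G0, -2 * Gh; 2 * starRingEnd ℂ Gh, (1 / 4 : ℂ) + 2 * G0] with hM
  have e0 : M.mulVec f 0 = σ * (-(1 / 4 : ℂ) - 2 * G0) * f 0 + σ * (-2 * Gh) * f 1 := by
    simp [hM, Matrix.mulVec, dotProduct, Fin.sum_univ_two, smul_eq_mul]
  have e1 : M.mulVec f 1 = σ * (2 * starRingEnd ℂ Gh) * f 0 + σ * ((1 / 4 : ℂ) + 2 * G0) * f 1 := by
    simp [hM, Matrix.mulVec, dotProduct, Fin.sum_univ_two, smul_eq_mul]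
  rw [e0, e1]
  linear_combination σ * ((-2 * starRingEnd ℂ Gh * ep * f 0 + 2 * Gh * em * f 1) * hpm - 2 * f 1 * ep * hrel)

/-- **`V(Xf) = x_uv · U(f)`:** `(Xf)₀e^{−iπb/2} − (Xf)₁e^{iπb/2} = 2πia(−¼ − 2G0 − 2Ḡh e^{iπb})·(f₀e^{−iπb/2} + f₁e^{iπb/2})`. [cite: Drazin2002, §8.3 (8.36)–(8.38)] -/
theorem frame_mulVec_V (a b : ℝ) {G0 Gh : ℂ}
    (hrel : Gh * Complex.exp (-((Real.pi * b : ℝ) : ℂ) * Complex.I) = starRingEnd ℂ Gh * Complex.exp (((Real.pi * b : ℝ) : ℂ) * Complex.I))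
    (f : Fin 2 → ℂ) :
    ((((2 * Real.pi * a : ℝ) : ℂ) * Complex.I) • !![-(1 / 4 : ℂ) - 2 * G0, -2 * Gh; 2 * starRingEnd ℂ Gh, (1 / 4 : ℂ) + 2 * G0]).mulVec f 0 *
          Complex.exp (-((Real.pi * b / 2 : ℝ) : ℂ) * Complex.I) -
        ((((2 * Real.pi * a : ℝ) : ℂ) * Complex.I) • !![-(1 / 4 : ℂ) - 2 * G0, -2 * Gh; 2 * starRingEnd ℂ Gh, (1 / 4 : ℂ) + 2 * G0]).mulVec f 1 *
          Complex.exp (((Real.pi * b / 2 : ℝ) : ℂ) * Complex.I) =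
      ((((2 * Real.pi * a : ℝ) : ℂ) * Complex.I) * (-(1 / 4 : ℂ) - 2 * G0 - 2 * starRingEnd ℂ Gh * Complex.exp (((Real.pi * b : ℝ) : ℂ) * Complex.I))) *
        (f 0 * Complex.exp (-((Real.pi * b / 2 : ℝ) : ℂ) * Complex.I) + f 1 * Complex.exp (((Real.pi * b / 2 : ℝ) : ℂ) * Complex.I)) := by
  set ep : ℂ := Complex.exp (((Real.pi * b / 2 : ℝ) : ℂ) * Complex.I) with hep
  set em : ℂ := Complex.exp (-((Real.pi * b / 2 : ℝ) : ℂ) * Complex.I) with hem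
  have hpm : ep * em = 1 := by rw [hep, hem, ← Complex.exp_add]; convert Complex.exp_zero using 2; push_cast; ring
  have hep2 : Complex.exp (((Real.pi * b : ℝ) : ℂ) * Complex.I) = ep ^ 2 := by rw [hep, sq, ← Complex.exp_add]; congr 1; push_cast; ring
  have hem2 : Complex.exp (-((Real.pi * b : ℝ) : ℂ) * Complex.I) = em ^ 2 := by rw [hem, sq, ← Complex.exp_add]; congr 1; push_cast; ring
  rw [hep2]
  rw [hep2, hem2] at hrel
  set σ : ℂ := (((2 * Real.pi * a : ℝ) : ℂ) * Complex.I) with hσ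
  set M : Matrix (Fin 2) (Fin 2) ℂ := σ • !![-(1 / 4 : ℂ) - 2 * G0, -2 * Gh; 2 * starRingEnd ℂ Gh, (1 / 4 : ℂ) + 2 * G0] with hM
  have e0 : M.mulVec f 0 = σ * (-(1 / 4 : ℂ) - 2 * G0) * f 0 + σ * (-2 * Gh) * f 1 := by
    simp [hM, Matrix.mulVec, dotProduct, Fin.sum_univ_two, smul_eq_mul]
  have e1 : M.mulVec f 1 = σ * (2 * starRingEnd ℂ Gh) * f 0 + σ * ((1 / 4 : ℂ) + 2 * G0) * f 1 := by
    simp [hM, Matrix.mulVec, dotProduct, Fin.sum_univ_two, smul_eq_mul]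
  rw [e0, e1]
  linear_combination σ * ((2 * starRingEnd ℂ Gh * ep * f 0 + 2 * Gh * em * f 1) * hpm - 2 * f 1 * ep * hrel)

/-- The frame coefficients in the tree's closed forms: with `2πG0 = Σ₀`, `2πḠh = S`,
`2πia(−¼ − 2G0 ± 2Ḡh e^{iπb}) = ia·((−π/2 − 2Σ₀) ± 2e^{iπb}S)`. [cite: Drazin2002, §8.3 (8.36)–(8.38)] -/
theorem frameCoef_eq {a b : ℝ} {G0 Gh : ℂ} (h0 : (2 * Real.pi : ℂ) * G0 = ((sawSigma0 a b : ℝ) : ℂ))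
    (hh : (2 * Real.pi : ℂ) * starRingEnd ℂ Gh = sawS a b) :
    (((2 * Real.pi * a : ℝ) : ℂ) * Complex.I) * (-(1 / 4 : ℂ) - 2 * G0 + 2 * starRingEnd ℂ Gh * Complex.exp (((Real.pi * b : ℝ) : ℂ) * Complex.I)) =
        Complex.I * a * ((((-(Real.pi / 2) - 2 * sawSigma0 a b) : ℝ) : ℂ) + 2 * (Complex.exp (((Real.pi * b : ℝ) : ℂ) * Complex.I) * sawS a b)) ∧
      (((2 * Real.pi * a : ℝ) : ℂ) * Complex.I) * (-(1 / 4 : ℂ) - 2 * G0 - 2 * starRingEnd ℂ Gh * Complex.exp (((Real.pi * b : ℝ) : ℂ) * Complex.I)) =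
        Complex.I * a * ((((-(Real.pi / 2) - 2 * sawSigma0 a b) : ℝ) : ℂ) - 2 * (Complex.exp (((Real.pi * b : ℝ) : ℂ) * Complex.I) * sawS a b)) := by
  rw [← hh]
  constructor
  · push_cast
    linear_combination (-(2 : ℂ) * a * Complex.I) * h0
  · push_cast
    linear_combination (-(2 : ℂ) * a * Complex.I) * h0

end Summit.AnomalousDissipation.AnomalousDissipation.Theorems.SawtoothPulseCascade.K2PhaseBudget

end
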